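import Mathlib
import Summits.ValiantsHypothesis.ValiantsHypothesis.Theorems.LacunarySymmetroidMatrixDescartesDefiniteMomentsBudgetLocal
import Summits.ValiantsHypothesis.ValiantsHypothesis.Theorems.LacunarySymmetroidMatrixDescartesDefiniteMomentsZonesPlanar

/-!
# `MatrixDescartes` (stmt-ValiantsHypothesis-18050) — the DEFINITE-MOMENTS LAW, budget zones III: the planar index argument
# and the pairwise zone order under the abstract budget bundle

HONEST FRAMING.  Cell `pub-symmetroid`, seat `val-sym-mdr-p2` (gen 15); helper file `--supports` the crux
`Theses.LacunarySymmetroid.MatrixDescartes`, NO closure claim.  Verbatim re-run of `…ZonesPlanar` (`planar_far`, `planar_touch`,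
`zone_pair_count`) with Descartes' budget `K − 1` replaced by an abstract budget `B ≥ 1` and the letter sign `σ` by the bundle's
sign `s`; nothing here bears on the crux in its window, on `stub_twoSided`, on `DoorA26`/`DoorA34`, registers, or `VP ≠ VNP`.
[folklore]; axioms standard; no definitions.
-/

-- layout Summits/ValiantsHypothesis/ValiantsHypothesis forces the duplicated namespace component
set_option linter.dupNamespace false

namespace Summit.ValiantsHypothesis.ValiantsHypothesis.Theorems.LacunarySymmetroidMatrixDescartes

open Polynomial Matrix Finset
open scoped BigOperators Topology

namespace DefiniteMoments

section BudgetPlanar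

variable {ι : Type} [Fintype ι]

/-- **PLANAR LEMMA, far case (budget bundle).**  Budget-sharp family (`B ≥ 1`), `v, w` independent, `x > 0` a root of neither `P_v` nor `P_w`:
then `N(x, v) ≤ N(x, w) + 1` and `N(x, w) ≤ N(x, v) + 1` (loop count along `u(t) = (1 − t²)v + 2t·w`). [folklore] -/
theorem budget_planar_far {K : ℕ} (d : Fin K → ℕ) (S : Fin K → Matrix ι ι ℝ) (hS : ∀ l, (S l).IsSymm) (B : ℕ) (hB1 : 1 ≤ B) (s : ℝ)
    (hB : ∀ u : ι → ℝ, ((∑ l, C (u ⬝ᵥ (S l *ᵥ u)) * (X : ℝ[X]) ^ d l).roots.filter (fun t => 0 < t)).card ≤ B)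
    (hsh : ∀ u : ι → ℝ, u ≠ 0 →
      B ≤ ((∑ l, C (u ⬝ᵥ (S l *ᵥ u)) * (X : ℝ[X]) ^ d l).roots.toFinset.filter (fun t => 0 < t)).card)
    (hs : ∀ u : ι → ℝ, u ≠ 0 → ∃ δ : ℝ, 0 < δ ∧ ∀ x : ℝ, 0 < x → x < δ →
      0 < s * (∑ l, C (u ⬝ᵥ (S l *ᵥ u)) * (X : ℝ[X]) ^ d l).eval x)
    (v w : ι → ℝ) (hind : ∀ a b : ℝ, a • v + b • w = 0 → a = 0 ∧ b = 0) {x : ℝ} (hx : 0 < x)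
    (hvx : v ⬝ᵥ ((∑ k, x ^ d k • S k) *ᵥ v) ≠ 0) (hwx : w ⬝ᵥ ((∑ k, x ^ d k • S k) *ᵥ w) ≠ 0) :
    ((∑ l, C (v ⬝ᵥ (S l *ᵥ v)) * (X : ℝ[X]) ^ d l).roots.toFinset.filter (fun t => 0 < t ∧ t < x)).card
        ≤ ((∑ l, C (w ⬝ᵥ (S l *ᵥ w)) * (X : ℝ[X]) ^ d l).roots.toFinset.filter (fun t => 0 < t ∧ t < x)).card + 1 ∧
      ((∑ l, C (w ⬝ᵥ (S l *ᵥ w)) * (X : ℝ[X]) ^ d l).roots.toFinset.filter (fun t => 0 < t ∧ t < x)).card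
        ≤ ((∑ l, C (v ⬝ᵥ (S l *ᵥ v)) * (X : ℝ[X]) ^ d l).roots.toFinset.filter (fun t => 0 < t ∧ t < x)).card + 1 := by
  classical
  set F := ∑ k, x ^ d k • S k with hF
  have hFs : F.IsSymm := isSymm_eval d S hS x
  set u : ℝ → ι → ℝ := fun t => (1 - t ^ 2) • v + (2 * t) • w with hu
  set I : ℝ → ℕ := fun t => ((∑ l, C (u t ⬝ᵥ (S l *ᵥ u t)) * (X : ℝ[X]) ^ d l).roots.toFinset.filter
      (fun s => 0 < s ∧ s < x)).card with hI
  set Q : ℝ → ℝ := fun t => u t ⬝ᵥ (F *ᵥ u t) with hQ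
  have hu0 : ∀ t, u t ≠ 0 := path_ne_zero v w hind
  have hucont : Continuous u := continuous_path v w
  have hQform : ∀ t, Q t = (1 - t ^ 2) ^ 2 * (v ⬝ᵥ (F *ᵥ v)) + 2 * (1 - t ^ 2) * (2 * t) * (v ⬝ᵥ (F *ᵥ w))
      + (2 * t) ^ 2 * (w ⬝ᵥ (F *ᵥ w)) := fun t => form_plane F hFs v w _ _
  have huv : u 0 = v := by simp [hu]
  have huw : u 1 = (2 : ℝ) • w := by simp [hu]
  have hum : u (-1) = (-2 : ℝ) • w := by simp [hu]
  have h1 : ∀ t₀ ∈ Set.Icc (-1 : ℝ) 1, Q t₀ ≠ 0 → ∀ᶠ t in 𝓝 t₀, I t = I t₀ := by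
    intro t₀ _ hQt₀
    obtain ⟨η, hη, hst⟩ := budget_count_stable_of_nonroot d S B hB1 s hB hsh hs (u t₀) (hu0 t₀) hx hQt₀
    have hev : ∀ᶠ t in 𝓝 t₀, dist (u t) (u t₀) < η := Metric.tendsto_nhds.1 (hucont.tendsto t₀) η hη
    exact hev.mono fun t ht => (hst (u t) ht).1
  have h2 : ∀ t₀ ∈ Set.Icc (-1 : ℝ) 1, Q t₀ = 0 → ∃ m : ℕ, ∀ᶠ t in 𝓝 t₀, m ≤ I t ∧ I t ≤ m + 1 := by
    intro t₀ _ hQt₀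
    obtain ⟨η, hη, hnr⟩ := budget_count_near_root d S B hB1 s hB hsh hs (u t₀) (hu0 t₀) hx hQt₀
    refine ⟨I t₀, ?_⟩
    have hev : ∀ᶠ t in 𝓝 t₀, dist (u t) (u t₀) < η := Metric.tendsto_nhds.1 (hucont.tendsto t₀) η hη
    refine hev.mono fun t ht => ?_
    obtain ⟨hlo, hhi, -⟩ := hnr (u t) ht
    exact ⟨hlo, (rootsBelow_le_rootsUpTo _ x).trans hhi⟩
  have hA : v ⬝ᵥ (F *ᵥ v) ≠ 0 := hvx
  have h3 : ∀ t₁ t₂ t₃ : ℝ, -1 < t₁ → t₁ < t₂ → t₂ < t₃ → t₃ < 1 → Q t₁ = 0 → Q t₂ = 0 → Q t₃ = 0 → False := by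
    intro t₁ t₂ t₃ h1' h12 h23 h3' hz1 hz2 hz3
    rw [hQform] at hz1 hz2 hz3
    exact path_no_three_zeros hA t₁ t₂ t₃ h1' h12 h23 h3' hz1 hz2 hz3
  have hQ0 : Q 0 ≠ 0 := by
    have e : Q 0 = v ⬝ᵥ (F *ᵥ v) := by rw [hQform]; ring
    rw [e]; exact hA
  have hQ1 : Q 1 ≠ 0 := by
    have e : Q 1 = 4 * (w ⬝ᵥ (F *ᵥ w)) := by rw [hQform]; ring
    rw [e]; exact mul_ne_zero (by norm_num) hwx
  have hQm1 : Q (-1) ≠ 0 := by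
    have e : Q (-1) = 4 * (w ⬝ᵥ (F *ᵥ w)) := by rw [hQform]; ring
    rw [e]; exact mul_ne_zero (by norm_num) hwx
  have hI0 : I 0 = ((∑ l, C (v ⬝ᵥ (S l *ᵥ v)) * (X : ℝ[X]) ^ d l).roots.toFinset.filter
      (fun s => 0 < s ∧ s < x)).card := by
    simp only [hI]; rw [huv]
  have hI1 : I 1 = ((∑ l, C (w ⬝ᵥ (S l *ᵥ w)) * (X : ℝ[X]) ^ d l).roots.toFinset.filter
      (fun s => 0 < s ∧ s < x)).card := by
    simp only [hI]; rw [huw, posRoots_smul d S two_ne_zero w]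
  have hIm1 : I (-1) = ((∑ l, C (w ⬝ᵥ (S l *ᵥ w)) * (X : ℝ[X]) ^ d l).roots.toFinset.filter
      (fun s => 0 < s ∧ s < x)).card := by
    simp only [hI]; rw [hum, posRoots_smul d S (by norm_num : (-2 : ℝ) ≠ 0) w]
  have h := loop_count I Q h1 h2 h3 hQ0 hQ1 hQm1 (hIm1.trans hI1.symm)
  rw [hI0, hI1] at h
  exact h

/-- **PLANAR LEMMA, touching case (budget bundle).**  Budget-sharp family with sign `s`, `v, w` independent, `x > 0` a
root of both `P_v` and `P_w` with `N(x, w) = N(x, v) + 1`: impossible.  (Along the loop the Rayleigh value at `x` is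
`4t(1−t²)·vᵀF(x)w`; if it vanishes identically the index is constant, else the parity law gives the two half-loops
opposite signs but equal index.) [folklore] -/
theorem budget_planar_touch {K : ℕ} (d : Fin K → ℕ) (S : Fin K → Matrix ι ι ℝ) (hS : ∀ l, (S l).IsSymm) (B : ℕ) (hB1 : 1 ≤ B) (s : ℝ)
    (hB : ∀ u : ι → ℝ, ((∑ l, C (u ⬝ᵥ (S l *ᵥ u)) * (X : ℝ[X]) ^ d l).roots.filter (fun t => 0 < t)).card ≤ B)
    (hsh : ∀ u : ι → ℝ, u ≠ 0 →
      B ≤ ((∑ l, C (u ⬝ᵥ (S l *ᵥ u)) * (X : ℝ[X]) ^ d l).roots.toFinset.filter (fun t => 0 < t)).card)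
    (hs : ∀ u : ι → ℝ, u ≠ 0 → ∃ δ : ℝ, 0 < δ ∧ ∀ x : ℝ, 0 < x → x < δ →
      0 < s * (∑ l, C (u ⬝ᵥ (S l *ᵥ u)) * (X : ℝ[X]) ^ d l).eval x)
    (v w : ι → ℝ) (hind : ∀ a b : ℝ, a • v + b • w = 0 → a = 0 ∧ b = 0) {x : ℝ} (hx : 0 < x)
    (hvx : v ⬝ᵥ ((∑ k, x ^ d k • S k) *ᵥ v) = 0) (hwx : w ⬝ᵥ ((∑ k, x ^ d k • S k) *ᵥ w) = 0)
    (hstep : ((∑ l, C (w ⬝ᵥ (S l *ᵥ w)) * (X : ℝ[X]) ^ d l).roots.toFinset.filter (fun t => 0 < t ∧ t < x)).card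
      = ((∑ l, C (v ⬝ᵥ (S l *ᵥ v)) * (X : ℝ[X]) ^ d l).roots.toFinset.filter (fun t => 0 < t ∧ t < x)).card + 1) :
    False := by
  classical
  set F := ∑ k, x ^ d k • S k with hF
  have hFs : F.IsSymm := isSymm_eval d S hS x
  set u : ℝ → ι → ℝ := fun t => (1 - t ^ 2) • v + (2 * t) • w with hu
  set I : ℝ → ℕ := fun t => ((∑ l, C (u t ⬝ᵥ (S l *ᵥ u t)) * (X : ℝ[X]) ^ d l).roots.toFinset.filter
      (fun s => 0 < s ∧ s < x)).card with hI
  set Q : ℝ → ℝ := fun t => u t ⬝ᵥ (F *ᵥ u t) with hQ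
  have hu0 : ∀ t, u t ≠ 0 := path_ne_zero v w hind
  have hucont : Continuous u := continuous_path v w
  have hQform : ∀ t, Q t = (1 - t ^ 2) ^ 2 * (v ⬝ᵥ (F *ᵥ v)) + 2 * (1 - t ^ 2) * (2 * t) * (v ⬝ᵥ (F *ᵥ w))
      + (2 * t) ^ 2 * (w ⬝ᵥ (F *ᵥ w)) := fun t => form_plane F hFs v w _ _
  have hA : v ⬝ᵥ (F *ᵥ v) = 0 := hvx
  have hC : w ⬝ᵥ (F *ᵥ w) = 0 := hwx
  have huv : u 0 = v := by simp [hu]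
  have huw : u 1 = (2 : ℝ) • w := by simp [hu]
  have hum : u (-1) = (-2 : ℝ) • w := by simp [hu]
  have h1 : ∀ t₀ ∈ Set.Icc (-1 : ℝ) 1, Q t₀ ≠ 0 → ∀ᶠ t in 𝓝 t₀, I t = I t₀ := by
    intro t₀ _ hQt₀
    obtain ⟨η, hη, hst⟩ := budget_count_stable_of_nonroot d S B hB1 s hB hsh hs (u t₀) (hu0 t₀) hx hQt₀
    have hev : ∀ᶠ t in 𝓝 t₀, dist (u t) (u t₀) < η := Metric.tendsto_nhds.1 (hucont.tendsto t₀) η hη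
    exact hev.mono fun t ht => (hst (u t) ht).1
  have h2 : ∀ t₀ ∈ Set.Icc (-1 : ℝ) 1, Q t₀ = 0 →
      ∀ᶠ t in 𝓝 t₀, I t₀ ≤ I t ∧ I t ≤ I t₀ + 1 ∧ (Q t = 0 → I t = I t₀) := by
    intro t₀ _ hQt₀
    obtain ⟨η, hη, hnr⟩ := budget_count_near_root d S B hB1 s hB hsh hs (u t₀) (hu0 t₀) hx hQt₀
    have hev : ∀ᶠ t in 𝓝 t₀, dist (u t) (u t₀) < η := Metric.tendsto_nhds.1 (hucont.tendsto t₀) η hη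
    refine hev.mono fun t ht => ?_
    obtain ⟨hlo, hhi, heq⟩ := hnr (u t) ht
    exact ⟨hlo, (rootsBelow_le_rootsUpTo _ x).trans hhi, heq⟩
  have hpar : ∀ t t' : ℝ, t ∈ Set.Icc (-1 : ℝ) 1 → t' ∈ Set.Icc (-1 : ℝ) 1 → Q t ≠ 0 → Q t' ≠ 0 → I t = I t' →
      0 < Q t * Q t' := by
    intro t t' _ _ hQt hQt' hIeq
    have hnr : ¬ (∑ l, C (u t ⬝ᵥ (S l *ᵥ u t)) * (X : ℝ[X]) ^ d l).IsRoot x :=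
      fun h => hQt ((isRoot_iff_form_eq_zero d S (u t) x).1 h)
    have hnr' : ¬ (∑ l, C (u t' ⬝ᵥ (S l *ᵥ u t')) * (X : ℝ[X]) ^ d l).IsRoot x :=
      fun h => hQt' ((isRoot_iff_form_eq_zero d S (u t') x).1 h)
    have hsg1 := budget_sign_law d S B s hB hsh hs (u t) (hu0 t) hx hnr
    have hsg2 := budget_sign_law d S B s hB hsh hs (u t') (hu0 t') hx hnr'
    change 0 < s * (-1) ^ (I t) * Q t at hsg1
    change 0 < s * (-1) ^ (I t') * Q t' at hsg2
    rw [hIeq] at hsg1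
    have hne : s * (-1) ^ (I t') ≠ 0 := by
      intro h0; rw [h0, zero_mul] at hsg2; exact lt_irrefl 0 hsg2
    have hm := mul_pos hsg1 hsg2
    have e : s * (-1) ^ I t' * Q t * (s * (-1) ^ I t' * Q t')
        = (s * (-1) ^ I t') * (s * (-1) ^ I t') * (Q t * Q t') := by ring
    rw [e] at hm
    exact (mul_pos_iff_of_pos_left (mul_self_pos.2 hne)).1 hm
  have hQalt : (∀ t ∈ Set.Icc (-1 : ℝ) 1, Q t = 0) ∨
      ((∀ t : ℝ, -1 < t → t < 1 → t ≠ 0 → Q t ≠ 0) ∧ Q (1 / 2) * Q (-1 / 2) < 0) := by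
    by_cases hB : v ⬝ᵥ (F *ᵥ w) = 0
    · left
      intro t _
      rw [hQform, hA, hC, hB]; ring
    · right
      obtain ⟨hnz, hsg⟩ := path_touch_values _ hB
      refine ⟨fun t ht1 ht2 ht0 => ?_, ?_⟩
      · rw [hQform, hA, hC]; exact hnz t ht1 ht2 ht0
      · rw [hQform, hQform, hA, hC]; exact hsg
  have hQ0 : Q 0 = 0 := by rw [hQform, hA]; ring
  have hQ1 : Q 1 = 0 := by rw [hQform, hC]; ring
  have hQm1 : Q (-1) = 0 := by rw [hQform, hC]; ring
  have hI0 : I 0 = ((∑ l, C (v ⬝ᵥ (S l *ᵥ v)) * (X : ℝ[X]) ^ d l).roots.toFinset.filter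
      (fun s => 0 < s ∧ s < x)).card := by
    simp only [hI]; rw [huv]
  have hI1 : I 1 = ((∑ l, C (w ⬝ᵥ (S l *ᵥ w)) * (X : ℝ[X]) ^ d l).roots.toFinset.filter
      (fun s => 0 < s ∧ s < x)).card := by
    simp only [hI]; rw [huw, posRoots_smul d S two_ne_zero w]
  have hIm1 : I (-1) = ((∑ l, C (w ⬝ᵥ (S l *ᵥ w)) * (X : ℝ[X]) ^ d l).roots.toFinset.filter
      (fun s => 0 < s ∧ s < x)).card := by
    simp only [hI]; rw [hum, posRoots_smul d S (by norm_num : (-2 : ℝ) ≠ 0) w]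
  refine touch_count I Q h1 h2 hpar hQalt hQ0 hQ1 hQm1 (hIm1.trans hI1.symm) ?_
  rw [hI1, hI0]; exact hstep

/-- **PAIRWISE ZONE ORDER (budget bundle).**  For a budget-sharp family with sign `s`, for all `v, w ≠ 0` and every `x > 0`:
`N⁺(x, w) ≤ N(x, v) + 1` — the number of roots of `P_w` in `(0, x]` exceeds the number of roots of `P_v` in `(0, x)` by at
most one; equivalently the `j`-th positive root of `P_v` lies strictly below the `(j+1)`-st of `P_w`.  (Proportional
vectors have the same roots; otherwise `planar_far` at a nearby common non-root, with `planar_touch` excluding the touching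
configuration.) [folklore] -/
theorem budget_zone_pair_count {K : ℕ} (d : Fin K → ℕ) (S : Fin K → Matrix ι ι ℝ) (hS : ∀ l, (S l).IsSymm) (B : ℕ) (hB1 : 1 ≤ B) (s : ℝ)
    (hB : ∀ u : ι → ℝ, ((∑ l, C (u ⬝ᵥ (S l *ᵥ u)) * (X : ℝ[X]) ^ d l).roots.filter (fun t => 0 < t)).card ≤ B)
    (hsh : ∀ u : ι → ℝ, u ≠ 0 →
      B ≤ ((∑ l, C (u ⬝ᵥ (S l *ᵥ u)) * (X : ℝ[X]) ^ d l).roots.toFinset.filter (fun t => 0 < t)).card)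
    (hs : ∀ u : ι → ℝ, u ≠ 0 → ∃ δ : ℝ, 0 < δ ∧ ∀ x : ℝ, 0 < x → x < δ →
      0 < s * (∑ l, C (u ⬝ᵥ (S l *ᵥ u)) * (X : ℝ[X]) ^ d l).eval x)
    (v w : ι → ℝ) (hv : v ≠ 0) (hw : w ≠ 0) {x : ℝ} (hx : 0 < x) :
    ((∑ l, C (w ⬝ᵥ (S l *ᵥ w)) * (X : ℝ[X]) ^ d l).roots.toFinset.filter (fun t => 0 < t ∧ t ≤ x)).card
      ≤ ((∑ l, C (v ⬝ᵥ (S l *ᵥ v)) * (X : ℝ[X]) ^ d l).roots.toFinset.filter (fun t => 0 < t ∧ t < x)).card + 1 := by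
  classical
  have hPv0 := budget_ne_zero d S s hs v hv
  have hPw0 := budget_ne_zero d S s hs w hw
  set Pv := ∑ l, C (v ⬝ᵥ (S l *ᵥ v)) * (X : ℝ[X]) ^ d l with hPv
  set Pw := ∑ l, C (w ⬝ᵥ (S l *ᵥ w)) * (X : ℝ[X]) ^ d l with hPw
  by_cases hind : ∀ a b : ℝ, a • v + b • w = 0 → a = 0 ∧ b = 0
  swap
  · -- proportional vectors: same roots
    push Not at hind
    obtain ⟨a, b, hab, hne⟩ := hind
    have hb : b ≠ 0 := by
      intro hb0
      rw [hb0, zero_smul, add_zero] at hab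
      rcases smul_eq_zero.1 hab with ha | hv0
      · exact hne ha hb0
      · exact hv hv0
    have ha : a ≠ 0 := by
      intro ha0
      rw [ha0, zero_smul, zero_add] at hab
      rcases smul_eq_zero.1 hab with hb' | hw0
      · exact hb hb'
      · exact hw hw0
    have hwv : w = (-a / b) • v := by
      have h1 : b • w = -(a • v) := eq_neg_of_add_eq_zero_right hab
      calc w = b⁻¹ • (b • w) := by rw [smul_smul, inv_mul_cancel₀ hb, one_smul]
        _ = (-a / b) • v := by rw [h1, smul_neg, smul_smul, ← neg_smul]; congr 1; rw [div_eq_mul_inv]; ring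
    have hc : -a / b ≠ 0 := div_ne_zero (neg_ne_zero.2 ha) hb
    have hroots : Pw.roots.toFinset = Pv.roots.toFinset := by
      rw [hPw, hwv, posRoots_smul d S hc v]
    rw [hroots]
    exact rootsUpTo_le_succ Pv x
  · have root_of_form : ∀ (u : ι → ℝ) (y : ℝ), u ⬝ᵥ ((∑ k, y ^ d k • S k) *ᵥ u) = 0 →
        (∑ l, C (u ⬝ᵥ (S l *ᵥ u)) * (X : ℝ[X]) ^ d l).IsRoot y :=
      fun u y h => (isRoot_iff_form_eq_zero d S u y).2 h
    by_cases hvx : v ⬝ᵥ ((∑ k, x ^ d k • S k) *ᵥ v) = 0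
    · -- `x` is a root of `P_v`: compare at a point just below `x`
      obtain ⟨x', hx'0, hx'x, hgap⟩ := exists_gap_below (Pv.roots.toFinset ∪ Pw.roots.toFinset) hx
      have hmemv : ∀ y, Pv.IsRoot y → y ∈ Pv.roots.toFinset ∪ Pw.roots.toFinset := fun y hy =>
        Finset.mem_union_left _ (Multiset.mem_toFinset.2 ((mem_roots hPv0).2 hy))
      have hmemw : ∀ y, Pw.IsRoot y → y ∈ Pv.roots.toFinset ∪ Pw.roots.toFinset := fun y hy =>
        Finset.mem_union_right _ (Multiset.mem_toFinset.2 ((mem_roots hPw0).2 hy))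
      have hv' : v ⬝ᵥ ((∑ k, x' ^ d k • S k) *ᵥ v) ≠ 0 := fun h =>
        hgap x' (hmemv x' (root_of_form v x' h)) ⟨le_rfl, hx'x⟩
      have hw' : w ⬝ᵥ ((∑ k, x' ^ d k • S k) *ᵥ w) ≠ 0 := fun h =>
        hgap x' (hmemw x' (root_of_form w x' h)) ⟨le_rfl, hx'x⟩
      have e1 := card_rootsBelow_eq_of_noRoot Pv hPv0 hx'x.le
        (fun z hz1 hz2 hroot => hgap z (hmemv z hroot) ⟨hz1, hz2⟩)
      have e2 := card_rootsBelow_eq_of_noRoot Pw hPw0 hx'x.le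
        (fun z hz1 hz2 hroot => hgap z (hmemw z hroot) ⟨hz1, hz2⟩)
      obtain ⟨-, hfar⟩ := budget_planar_far d S hS B hB1 s hB hsh hs v w hind hx'0 hv' hw'
      rw [← hPv, ← hPw] at hfar
      rw [e1, e2] at hfar
      by_cases hwx : w ⬝ᵥ ((∑ k, x ^ d k • S k) *ᵥ w) = 0
      · have hne : (Pw.roots.toFinset.filter (fun t => 0 < t ∧ t < x)).card
            ≠ (Pv.roots.toFinset.filter (fun t => 0 < t ∧ t < x)).card + 1 :=
          fun h => budget_planar_touch d S hS B hB1 s hB hsh hs v w hind hx hvx hwx h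
        rw [rootsUpTo_eq_succ_of_root Pw hPw0 hx (root_of_form w x hwx)]
        omega
      · rw [rootsUpTo_eq_rootsBelow_of_nonroot Pw hPw0 (fun h => hwx ((isRoot_iff_form_eq_zero d S w x).1 h))]
        exact hfar
    · by_cases hwx : w ⬝ᵥ ((∑ k, x ^ d k • S k) *ᵥ w) = 0
      · -- `x` is a root of `P_w` only: compare at a point just above `x`
        obtain ⟨x', hxx', hgap⟩ := exists_gap_above (Pv.roots.toFinset ∪ Pw.roots.toFinset) x
        have hx'0 : 0 < x' := hx.trans hxx'
        have hmemv : ∀ y, Pv.IsRoot y → y ∈ Pv.roots.toFinset ∪ Pw.roots.toFinset := fun y hy =>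
          Finset.mem_union_left _ (Multiset.mem_toFinset.2 ((mem_roots hPv0).2 hy))
        have hmemw : ∀ y, Pw.IsRoot y → y ∈ Pv.roots.toFinset ∪ Pw.roots.toFinset := fun y hy =>
          Finset.mem_union_right _ (Multiset.mem_toFinset.2 ((mem_roots hPw0).2 hy))
        have hv' : v ⬝ᵥ ((∑ k, x' ^ d k • S k) *ᵥ v) ≠ 0 := fun h =>
          hgap x' (hmemv x' (root_of_form v x' h)) ⟨hxx', le_rfl⟩
        have hw' : w ⬝ᵥ ((∑ k, x' ^ d k • S k) *ᵥ w) ≠ 0 := fun h =>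
          hgap x' (hmemw x' (root_of_form w x' h)) ⟨hxx', le_rfl⟩
        have e1 := card_rootsBelow_eq_of_noRoot Pv hPv0 hxx'.le (fun z hz1 hz2 hroot => by
          rcases hz1.lt_or_eq with hlt | heq
          · exact hgap z (hmemv z hroot) ⟨hlt, hz2.le⟩
          · rw [← heq] at hroot; exact hvx ((isRoot_iff_form_eq_zero d S v x).1 hroot))
        have e2 := rootsBelow_eq_rootsUpTo_of_gap Pw hPw0 hxx'
          (fun t ht h => hgap t (hmemw t ht) ⟨h.1, h.2.le⟩)
        obtain ⟨-, hfar⟩ := budget_planar_far d S hS B hB1 s hB hsh hs v w hind hx'0 hv' hw'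
        rw [← hPv, ← hPw] at hfar
        rw [← e1, e2] at hfar
        exact hfar
      · -- `x` is a root of neither
        obtain ⟨-, hfar⟩ := budget_planar_far d S hS B hB1 s hB hsh hs v w hind hx hvx hwx
        rw [← hPv, ← hPw] at hfar
        rw [rootsUpTo_eq_rootsBelow_of_nonroot Pw hPw0 (fun h => hwx ((isRoot_iff_form_eq_zero d S w x).1 h))]
        exact hfar


end BudgetPlanar

end DefiniteMoments

end Summit.ValiantsHypothesis.ValiantsHypothesis.Theorems.LacunarySymmetroidMatrixDescartes
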